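import Literature.NumberTheory.Automorphic.MeyerSummationPoisson
import HarnessLib

/-!
# Meyer's global difference representation — proofs, IV: `H₊ = i₊(𝒮(𝔸_K))`

Topic `NumberTheory/Automorphic`; namespace `Literature.NumberTheory.Automorphic.Meyer`. Sibling
PROOF file of `MeyerDifferenceRepresentation`. The file `MeyerDifferenceRepresentation` realises
Meyer's `H₊ = 𝒮(𝔸_K)/Kˣ` [Meyer2005, (1.1)] as the `ℂ`-span of all `C_K`-translates of the
vectors `i₊ F = (Σ F, J Σ 𝔉 F)`, `F ∈ 𝒮(𝔸_K)`, and remarks that "the translates and the span are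
redundant by the equivariance and linearity of `i₊`". This file PROVES that redundancy:

* `summable_units_of_mem` — `a ↦ F(a x)` is summable over `Kˣ` for `F ∈ 𝒮(𝔸_K)`;
  `ideleSum_add_of_mem`, `meyerSum_add_of_mem`, `meyerSum_smul`, `adeleFourier_add_of_mem`,
  `adeleFourier_smul`, **`iPlus_add_of_mem`, `iPlus_smul`** — linearity of `Σ`, `𝔉`, `i₊` on
  `𝒮(𝔸_K)` [Meyer2005, Lemma 5.3–5.4];
* **`classTranslate₂_mk_iPlus`** — equivariance `(λ ⊕ λ)_{[x]} (i₊ F) = i₊ (λ_x F)` for every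
  idele `x` (with `𝔉(λ_x F) = |x| · (𝔉F)(x ·)` from `adeleFourier_comp_mul`) [Meyer2005,
  Lemma 5.4: "`i₊` is `C_K`-equivariant"];
* **`mem_Hplus_iff`** — `p ∈ H₊ ↔ ∃ F ∈ 𝒮(𝔸_K), p = i₊ F`, i.e. `H₊ = i₊(𝒮(𝔸_K))` as a set
  [Meyer2005, §5.3: "we may identify `H₊` with its image `i₊(H₊)`"], and the diagonal form
  `mem_Hplus_of_diag_iff` : `(h, h) ∈ H₊ ↔ ∃ F ∈ 𝒮(𝔸_K), Σ F = h ∧ J Σ 𝔉 F = h`.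

Everything is proved; no definitions, no named facts (Step B of the plan for
`Meyer.spectralRealisation_rat`; also used by `Meyer.piPlus_two_dimensional`).

## References

* R. Meyer, *On a representation of the idele class group related to primes and zeros of
  L-functions*, Duke Math. J. 127 (2005) = arXiv:math/0311468, §1 (1.1), (1.4), §5.3,
  Lemmas 5.3–5.4 [Meyer2005].
-/

noncomputable section

open MeasureTheory MeasureTheory.Measure NumberField IsDedekindDomain
open scoped NNReal

namespace Literature.NumberTheory.Automorphic.Meyer

section Linearity

variable {K : Type} [Field K] [NumberField K]

/-- For `F ∈ 𝒮(𝔸_K)` and an idele `x`, `a ↦ F(a x)` is summable over `Kˣ`. [cite: Meyer2005, §5.3] -/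
theorem summable_units_of_mem {F : AdeleRing (𝓞 K) K → ℂ} (hF : F ∈ schwartzBruhatAdele K)
    (x : GaloisRepresentations.ideleGroup K) :
    Summable fun a : Kˣ => F (algebraMap K (AdeleRing (𝓞 K) K) (a : K) * (x : AdeleRing (𝓞 K) K)) := by
  have hgS : (fun y => F ((x : AdeleRing (𝓞 K) K) * y)) ∈ schwartzBruhatAdele K := by
    have h := adeleDilation_mem_schwartzBruhatAdele hF x⁻¹
    have hfun : adeleDilation K x⁻¹ F = fun y => F ((x : AdeleRing (𝓞 K) K) * y) := by
      funext y
      rw [adeleDilation_apply, inv_inv]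
    rwa [hfun] at h
  have h := (summable_algebraMap_of_mem hgS).comp_injective (Units.val_injective (α := K))
  refine h.congr fun a => ?_
  simp only [Function.comp_apply, mul_comm]

/-- Additivity of `Σ` on `𝒮(𝔸_K)` (idelic form). [cite: Meyer2005, Lemma 5.3] -/
theorem ideleSum_add_of_mem {F G : AdeleRing (𝓞 K) K → ℂ} (hF : F ∈ schwartzBruhatAdele K)
    (hG : G ∈ schwartzBruhatAdele K) (x : GaloisRepresentations.ideleGroup K) :
    ideleSum K (F + G) x = ideleSum K F x + ideleSum K G x := by
  unfold ideleSum
  simp only [Pi.add_apply]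
  exact (summable_units_of_mem hF x).tsum_add (summable_units_of_mem hG x)

omit [NumberField K] in
/-- Homogeneity of `Σ` (idelic form). [cite: Meyer2005, Lemma 5.3] -/
theorem ideleSum_smul [NumberField K] (c : ℂ) (F : AdeleRing (𝓞 K) K → ℂ) (x : GaloisRepresentations.ideleGroup K) :
    ideleSum K (c • F) x = c * ideleSum K F x := by
  unfold ideleSum
  simp only [Pi.smul_apply, smul_eq_mul]
  exact tsum_mul_left

/-- **Additivity of `Σ : 𝒮(𝔸_K) → (C_K → ℂ)`.** [cite: Meyer2005, Lemma 5.3] -/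
theorem meyerSum_add_of_mem {F G : AdeleRing (𝓞 K) K → ℂ} (hF : F ∈ schwartzBruhatAdele K)
    (hG : G ∈ schwartzBruhatAdele K) : meyerSum K (F + G) = meyerSum K F + meyerSum K G := by
  funext c
  induction c using QuotientGroup.induction_on with
  | H x => rw [Pi.add_apply, meyerSum_mk, meyerSum_mk, meyerSum_mk, ideleSum_add_of_mem hF hG]

/-- **Homogeneity of `Σ`.** [cite: Meyer2005, Lemma 5.3] -/
theorem meyerSum_smul (c : ℂ) (F : AdeleRing (𝓞 K) K → ℂ) : meyerSum K (c • F) = c • meyerSum K F := by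
  funext x
  induction x using QuotientGroup.induction_on with
  | H x => rw [Pi.smul_apply, meyerSum_mk, meyerSum_mk, ideleSum_smul, smul_eq_mul]

/-- `Σ 0 = 0`. [folklore] -/
theorem meyerSum_zero : meyerSum K (0 : AdeleRing (𝓞 K) K → ℂ) = 0 := by
  have h := meyerSum_smul (K := K) 0 (0 : AdeleRing (𝓞 K) K → ℂ)
  rwa [zero_smul, zero_smul] at h

variable [MeasurableSpace (AdeleRing (𝓞 K) K)] [BorelSpace (AdeleRing (𝓞 K) K)]
  (μ : Measure (AdeleRing (𝓞 K) K)) [μ.IsAddHaarMeasure]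

/-- `F ∈ 𝒮(𝔸_K)` is integrable for every Haar measure (transport of
`integrable_of_mem_piSchwartzBruhat`). [folklore] -/
theorem integrable_of_mem {F : AdeleRing (𝓞 K) K → ℂ} (hF : F ∈ schwartzBruhatAdele K) :
    Integrable (fun v : Fin 1 → AdeleRing (𝓞 K) K => F (v 0))
      (μ.map (MeasurableEquiv.funUnique (Fin 1) (AdeleRing (𝓞 K) K)).symm) := by
  haveI := isAddHaarMeasure_map_funUnique_symm μ
  exact integrable_of_mem_piSchwartzBruhat (mem_schwartzBruhatAdele_iff.mp hF)

/-- **Additivity of `𝔉` on `𝒮(𝔸_K)`.** [cite: Meyer2005, §5.1] -/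
theorem adeleFourier_add_of_mem {F G : AdeleRing (𝓞 K) K → ℂ} (hF : F ∈ schwartzBruhatAdele K)
    (hG : G ∈ schwartzBruhatAdele K) :
    adeleFourier K μ (F + G) = adeleFourier K μ F + adeleFourier K μ G := by
  funext ξ
  rw [Pi.add_apply, adeleFourier_eq_adelicPiFourier, adeleFourier_eq_adelicPiFourier,
    adeleFourier_eq_adelicPiFourier]
  have h := adelicPiFourier_add (K := K) (ι := Fin 1)
    (ν := μ.map (MeasurableEquiv.funUnique (Fin 1) (AdeleRing (𝓞 K) K)).symm)
    (integrable_of_mem μ hF) (integrable_of_mem μ hG)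
  exact congrFun h (fun _ => ξ)

omit [BorelSpace (AdeleRing (𝓞 K) K)] [μ.IsAddHaarMeasure] in
/-- **Homogeneity of `𝔉`.** [cite: Meyer2005, §5.1] -/
theorem adeleFourier_smul (c : ℂ) (F : AdeleRing (𝓞 K) K → ℂ) :
    adeleFourier K μ (c • F) = c • adeleFourier K μ F := by
  funext ξ
  unfold adeleFourier
  simp only [Pi.smul_apply, smul_eq_mul, mul_assoc, integral_const_mul]

omit [BorelSpace (AdeleRing (𝓞 K) K)] [μ.IsAddHaarMeasure] in
/-- `𝔉 0 = 0`. [folklore] -/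
theorem adeleFourier_zero : adeleFourier K μ (0 : AdeleRing (𝓞 K) K → ℂ) = 0 := by
  have h := adeleFourier_smul (K := K) μ 0 (0 : AdeleRing (𝓞 K) K → ℂ)
  rwa [zero_smul, zero_smul] at h

/-- **Additivity of `i₊` on `𝒮(𝔸_K)`.** [cite: Meyer2005, Lemma 5.4] -/
theorem iPlus_add_of_mem {F G : AdeleRing (𝓞 K) K → ℂ} (hF : F ∈ schwartzBruhatAdele K)
    (hG : G ∈ schwartzBruhatAdele K) : iPlus K μ (F + G) = iPlus K μ F + iPlus K μ G := by
  rw [iPlus, iPlus, iPlus, Prod.mk_add_mk, meyerSum_add_of_mem hF hG, adeleFourier_add_of_mem μ hF hG,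
    meyerSum_add_of_mem (adeleFourier_mem_schwartzBruhatAdele μ hF)
      (adeleFourier_mem_schwartzBruhatAdele μ hG), map_add]

omit [BorelSpace (AdeleRing (𝓞 K) K)] [μ.IsAddHaarMeasure] in
/-- **Homogeneity of `i₊`.** [cite: Meyer2005, Lemma 5.4] -/
theorem iPlus_smul (c : ℂ) (F : AdeleRing (𝓞 K) K → ℂ) : iPlus K μ (c • F) = c • iPlus K μ F := by
  rw [iPlus, iPlus, Prod.smul_mk, meyerSum_smul, adeleFourier_smul, meyerSum_smul, map_smul]

omit [BorelSpace (AdeleRing (𝓞 K) K)] [μ.IsAddHaarMeasure] in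
/-- `i₊ 0 = 0`. [folklore] -/
theorem iPlus_zero : iPlus K μ (0 : AdeleRing (𝓞 K) K → ℂ) = 0 := by
  have h := iPlus_smul (K := K) μ 0 (0 : AdeleRing (𝓞 K) K → ℂ)
  rwa [zero_smul, zero_smul] at h

end Linearity

/-! ### Equivariance of `i₊` and `H₊ = i₊(𝒮(𝔸_K))` -/

section Equivariance

variable {K : Type} [Field K] [NumberField K]

/-- Equivariance of `Σ`: `λ_{[x]} (Σ F) = Σ (λ_x F)` for every idele `x` (reindexing is not even
needed: both sides are `∑_a F(x⁻¹ a y)`). [cite: Meyer2005, Lemma 5.3] -/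
theorem classTranslate_mk_meyerSum (x : GaloisRepresentations.ideleGroup K) (F : AdeleRing (𝓞 K) K → ℂ) :
    classTranslate K (IdeleClassGroup.mk K x) (meyerSum K F) = meyerSum K (adeleDilation K x F) := by
  funext c
  induction c using QuotientGroup.induction_on with
  | H y =>
    rw [classTranslate_apply, IdeleClassGroup.mk_apply, ← QuotientGroup.mk_inv, ← QuotientGroup.mk_mul,
      meyerSum_mk, meyerSum_mk]
    unfold ideleSum
    refine tsum_congr fun a => ?_
    rw [adeleDilation_apply, Units.val_mul, mul_left_comm]

variable [MeasurableSpace (AdeleRing (𝓞 K) K)] [BorelSpace (AdeleRing (𝓞 K) K)]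
  (μ : Measure (AdeleRing (𝓞 K) K)) [μ.IsAddHaarMeasure]

/-- `𝔉(λ_x F) = |x| · (𝔉F)(x ·)` for every idele `x`. [cite: Meyer2005, §3.1] -/
theorem adeleFourier_adeleDilation (x : GaloisRepresentations.ideleGroup K) (F : AdeleRing (𝓞 K) K → ℂ)
    (ξ : AdeleRing (𝓞 K) K) :
    adeleFourier K μ (adeleDilation K x F) ξ =
      ((IdeleClassGroup.ideleNorm K x : ℝ≥0) : ℂ) * adeleFourier K μ F ((x : AdeleRing (𝓞 K) K) * ξ) := by
  have h := adeleFourier_comp_mul μ F x⁻¹ ξ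
  simp only [inv_inv] at h
  have hfun : adeleDilation K x F = fun y => F (((x⁻¹ : GaloisRepresentations.ideleGroup K) :
      AdeleRing (𝓞 K) K) * y) := by
    funext y
    rw [adeleDilation_apply]
  rw [hfun, h]

/-- **Equivariance of `i₊`** [Meyer2005, Lemma 5.4]: `(λ ⊕ λ)_{[x]} (i₊ F) = i₊ (λ_x F)` for every
idele `x` and every `F` (second component: `J λ_{[x]} = |x| λ_{[x]⁻¹} J` against
`𝔉 λ_x = |x| λ_{x⁻¹}-dilate`). [cite: Meyer2005, Lemma 5.4] -/
theorem classTranslate₂_mk_iPlus (x : GaloisRepresentations.ideleGroup K) (F : AdeleRing (𝓞 K) K → ℂ) :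
    classTranslate₂ K (IdeleClassGroup.mk K x) (iPlus K μ F) = iPlus K μ (adeleDilation K x F) := by
  rw [classTranslate₂_apply, iPlus, iPlus]
  refine Prod.ext (classTranslate_mk_meyerSum x F) ?_
  funext c
  induction c using QuotientGroup.induction_on with
  | H y =>
    change classTranslate K (IdeleClassGroup.mk K x) (invJ K (meyerSum K (adeleFourier K μ F))) (y : IdeleClassGroup K) =
      invJ K (meyerSum K (adeleFourier K μ (adeleDilation K x F))) (y : IdeleClassGroup K)
    rw [classTranslate_apply, IdeleClassGroup.mk_apply, invJ_apply, invJ_apply]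
    have hinv : (((x : IdeleClassGroup K))⁻¹ * (y : IdeleClassGroup K))⁻¹ =
        ((y⁻¹ * x : GaloisRepresentations.ideleGroup K) : IdeleClassGroup K) := by
      rw [QuotientGroup.mk_mul, QuotientGroup.mk_inv]
      exact (mul_inv_rev _ _).trans (congrArg _ (inv_inv (x : IdeleClassGroup K)))
    have hinv' : ((y : IdeleClassGroup K))⁻¹ = ((y⁻¹ : GaloisRepresentations.ideleGroup K) : IdeleClassGroup K) := rfl
    rw [hinv, hinv', meyerSum_mk, meyerSum_mk]
    -- norms
    have hn1 : classNorm K (((x : IdeleClassGroup K))⁻¹ * (y : IdeleClassGroup K)) =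
        (IdeleClassGroup.ideleNorm K x : ℝ)⁻¹ * (IdeleClassGroup.ideleNorm K y : ℝ) := by
      rw [classNorm_mul, classNorm, classNorm, map_inv, NNReal.coe_inv]
      rfl
    have hn2 : classNorm K (y : IdeleClassGroup K) = (IdeleClassGroup.ideleNorm K y : ℝ) := rfl
    rw [hn1, hn2]
    -- the sums
    unfold ideleSum
    simp_rw [adeleFourier_adeleDilation μ x F]
    rw [tsum_mul_left]
    have hx0 : ((IdeleClassGroup.ideleNorm K x : ℝ) : ℂ) ≠ 0 := by
      exact_mod_cast NNReal.coe_ne_zero.mpr (left_ne_zero_of_mul_eq_one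
        (by rw [← map_mul, mul_inv_cancel, map_one] : IdeleClassGroup.ideleNorm K x * IdeleClassGroup.ideleNorm K x⁻¹ = 1))
    have hterm : ∀ a : Kˣ, adeleFourier K μ F ((x : AdeleRing (𝓞 K) K) *
        (algebraMap K (AdeleRing (𝓞 K) K) (a : K) * ((y⁻¹ : GaloisRepresentations.ideleGroup K) : AdeleRing (𝓞 K) K))) =
        adeleFourier K μ F (algebraMap K (AdeleRing (𝓞 K) K) (a : K) *
          ((y⁻¹ * x : GaloisRepresentations.ideleGroup K) : AdeleRing (𝓞 K) K)) := fun a => by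
      rw [Units.val_mul, mul_left_comm, mul_comm (x : AdeleRing (𝓞 K) K)]
    simp_rw [hterm]
    push_cast
    field_simp

/-- **`H₊ = i₊(𝒮(𝔸_K))`** [Meyer2005, §5.3]: membership in Meyer's `H₊` (the span of the translates
of `i₊(𝒮(𝔸_K))`) is being of the form `i₊ F`, `F ∈ 𝒮(𝔸_K)` — the translates and the span add
nothing, by the equivariance and the linearity of `i₊`. [cite: Meyer2005, §5.3] -/
theorem mem_Hplus_iff {p : (IdeleClassGroup K → ℂ) × (IdeleClassGroup K → ℂ)} :
    p ∈ Hplus K μ ↔ ∃ F ∈ schwartzBruhatAdele K, p = iPlus K μ F := by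
  constructor
  · intro hp
    induction hp using Submodule.span_induction with
    | mem p h =>
      obtain ⟨c, F, hF, rfl⟩ := h
      induction c using QuotientGroup.induction_on with
      | H x =>
        refine ⟨adeleDilation K x F, adeleDilation_mem_schwartzBruhatAdele hF x, ?_⟩
        rw [← classTranslate₂_mk_iPlus μ x F]
        rfl
    | zero => exact ⟨0, zero_mem _, (iPlus_zero μ).symm⟩
    | add p q _ _ ihp ihq =>
      obtain ⟨F, hF, rfl⟩ := ihp
      obtain ⟨G, hG, rfl⟩ := ihq
      exact ⟨F + G, add_mem hF hG, (iPlus_add_of_mem μ hF hG).symm⟩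
    | smul a p _ ih =>
      obtain ⟨F, hF, rfl⟩ := ih
      exact ⟨a • F, Submodule.smul_mem _ a hF, (iPlus_smul μ a F).symm⟩
  · rintro ⟨F, hF, rfl⟩
    exact iPlus_mem_Hplus hF

/-- **Diagonal vectors of `H₊`**: `(h, h) ∈ H₊ ↔ ∃ F ∈ 𝒮(𝔸_K), Σ F = h ∧ J Σ 𝔉 F = h` — the form
in which `H₊ ∩ H₋` is computed [Meyer2005, §5.5]. [cite: Meyer2005, §5.5] -/
theorem mem_Hplus_of_diag_iff {h : IdeleClassGroup K → ℂ} :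
    (h, h) ∈ Hplus K μ ↔ ∃ F ∈ schwartzBruhatAdele K,
      meyerSum K F = h ∧ invJ K (meyerSum K (adeleFourier K μ F)) = h := by
  rw [mem_Hplus_iff]
  constructor
  · rintro ⟨F, hF, hp⟩
    rw [iPlus, Prod.ext_iff] at hp
    exact ⟨F, hF, hp.1.symm, hp.2.symm⟩
  · rintro ⟨F, hF, h1, h2⟩
    exact ⟨F, hF, by rw [iPlus, h1, h2]⟩

end Equivariance

end Literature.NumberTheory.Automorphic.Meyer
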